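import Literature.AlgebraicGeometry.HodgeTheory.RealSl2BlocksProducts
import Literature.AlgebraicGeometry.HodgeTheory.FiniteProductsMixedPowersRetract
import Literature.AlgebraicGeometry.HodgeTheory.NoTypeIVFactorProductsHodgeConjecture
import HarnessLib

/-!
# Finite products of pairwise orthogonal abelian varieties with real `𝔰𝔩₂`-block data: condition (D) and the Hodge conjecture for all powers (Hazama 1989; Moonen–Zarhin 1999 Thm. (3.2)(1), iterated)

Family `hodge`, layer `Literature/AlgebraicGeometry/HodgeTheory`. Research context: cell `pub-hodge-ring2`
(HONEST FRAMING: research route conditional on HC_CM; not a corollary; Q11.4-sentence-2 already refuted in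
dim ≥ 3), Literature lane, programme R3. UNCONDITIONAL; no definition (the iterated product `AbelianVariety.finProd`
lives in `FiniteProductsMixedPowersRetract`); no named fact.

* the orthogonality lemmas `hom_finProd_eq_zero`, `hom_to_finProd_eq_zero`;
* **`hasRealSl2Blocks_finProd`** — a finite family of abelian varieties with real `𝔰𝔩₂`-block data
  (`RealSl2Blocks.HasRealSl2Blocks`; e.g. `End⁰(A_i)` totally real fields of degree `dim A_i`) and PAIRWISE ORTHOGONAL
  (`Hom(A_i, A_j) = 0` for `i ≠ j`; e.g. simple and pairwise non-isogenous) has a product with real `𝔰𝔩₂`-block data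
  (induction on `k` with `HasRealSl2Blocks.prod`);
* hence **`isStablyNondegenerate_finProd`** (condition (D) for `A₀ × ⋯ × A_k`), **`hodgeConjectureFor_finProd_powSucc`**
  (the Hodge conjecture for every power of the product, unconditionally) and the isogeny closure;
  **`isDivisorGenerated_finProd_mixedPowers`, `hodgeConjectureFor_finProd_mixedPowers`** — `B = D` and the Hodge
  conjecture for every `A₀^{n₀+1} × ⋯ × A_k^{n_k+1}` (retract of a power of the product, `FiniteProductsMixedPowersRetract`);
  `hasRealSl2Blocks_finProd_of_isTotallyReal`, `hodgeConjectureFor_finProd_mixedPowers_of_isTotallyReal` — the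
  real-multiplication instance («products of pairwise non-isogenous abelian varieties `X_i` with `End⁰(X_i)` totally real
  of degree `dim X_i` satisfy (D)», Moonen–Zarhin (3.2)(1) iterated; Hazama 1989);
* `mem_hodgeLie_hodge_one_finProd_iff` — the Lie clause `Lie Hg(Π A_i) = 𝔰𝔭_{End⁰}(H¹, ψ)`;
* `hodgeConjectureFor_finProd_mixedPowers_prod_cmType_of_cmHodgeHypothesis` (+ `_of_isTotallyReal_`) — the
  product-lane row `(Π A_i^{n_i+1}) × C`, `C` of CM type, conditional on HC_CM (`hCM`) and the span fact (`hL`)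
  exactly as in `NoTypeIVFactorProductsHodgeConjecture`; the first factor unconditional;
* `…_of_isSimple` variants — the same statements for SIMPLE, PAIRWISE NON-ISOGENOUS `A_i` (the sources' phrasing;
  orthogonality by `orthogonal_of_isSimple_of_not_isIsogenous₂`);
* **`isStablyNondegenerate_finProd_mixedPowers`** (+ `_of_isTotallyReal`, `_of_isSimple`,
  `HasRealSl2Blocks.isStablyNondegenerate_powSucc_prod_powSucc`) — condition (D) for ALL mixed powers.

## References

* [MoonenZarhin1999LowDim] B. Moonen, Yu. Zarhin, Duke Math. J. 98 (1999), §3 Thm. (3.2)(1). [cite: MoonenZarhin1999LowDim, §3 Thm. (3.2)(1)]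
* [Hazama1989] F. Hazama, Duke Math. J. 58 (1989). [cite: Hazama1989, Thm. (= Gordon 7.6.2)]
* [Gordon1999HodgeAVSurvey] B. B. Gordon, Thm. 7.6.2. [cite: Gordon1999HodgeAVSurvey, Thm. 7.6.2]
* [MumfordAV1970] D. Mumford, *Abelian Varieties*, §19. [cite: MumfordAV1970, §19 (Hom(C, A × B) = Hom(C, A) ⊕ Hom(C, B))]
* [Lombardo2016] D. Lombardo, Lemma 3.4. [cite: Lombardo2016, Lemma 3.4 (p. 1229)]
* [Ribet1983] K. A. Ribet, Amer. J. Math. 105 (1983), Thm. 0–1. [cite: Ribet1983, Thm. 0–1]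
-/

noncomputable section

open CategoryTheory Module NumberField

namespace Literature.AlgebraicGeometry.HodgeTheory

open Literature.AlgebraicTopology.SingularHomology
open Literature.AlgebraicGeometry.Motives (AbelianVariety bettiCohomology HodgeTensorFacts)
open Literature.Barriers.HodgeConjecture
open Literature.AlgebraicGeometry.Motives.HodgeStructure
open Literature.AlgebraicGeometry.ComplexMultiplication

/-- `Hom(A₀ × ⋯ × A_k, C) = 0` if every `Hom(A_i, C) = 0`. [cite: MumfordAV1970, §19 (Hom(C, A × B) = Hom(C, A) ⊕ Hom(C, B))] -/
theorem hom_finProd_eq_zero : ∀ (k : ℕ) (A : Fin (k + 1) → AbelianVariety ℂ) {C : AbelianVariety ℂ},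
    (∀ i, ∀ f : A i ⟶ C, f = 0) → ∀ f : AbelianVariety.finProd k A ⟶ C, f = 0
  | 0, _, _, h => h 0
  | k + 1, A, _, h =>
    hom_prod_eq_zero_of_orthogonal (hom_finProd_eq_zero k (fun i => A i.castSucc) fun i => h i.castSucc)
      (h (Fin.last (k + 1)))

/-- `Hom(C, A₀ × ⋯ × A_k) = 0` if every `Hom(C, A_i) = 0`. [cite: MumfordAV1970, §19 (Hom(C, A × B) = Hom(C, A) ⊕ Hom(C, B))] -/
theorem hom_to_finProd_eq_zero : ∀ (k : ℕ) (A : Fin (k + 1) → AbelianVariety ℂ) {C : AbelianVariety ℂ},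
    (∀ i, ∀ f : C ⟶ A i, f = 0) → ∀ f : C ⟶ AbelianVariety.finProd k A, f = 0
  | 0, _, _, h => h 0
  | k + 1, A, _, h =>
    hom_to_prod_eq_zero_of_orthogonal (hom_to_finProd_eq_zero k (fun i => A i.castSucc) fun i => h i.castSucc)
      (h (Fin.last (k + 1)))

/-- **A finite product of pairwise orthogonal abelian varieties with real `𝔰𝔩₂`-block data has real `𝔰𝔩₂`-block
data** (induction with `HasRealSl2Blocks.prod`; Moonen–Zarhin Thm. (3.2)(1) iterated).
[cite: MoonenZarhin1999LowDim, §3 Thm. (3.2)(1)] [cite: Hazama1989, Thm. (= Gordon 7.6.2)] -/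
theorem hasRealSl2Blocks_finProd : ∀ (k : ℕ) (A : Fin (k + 1) → AbelianVariety ℂ),
    (∀ i, HasRealSl2Blocks (A i)) → (∀ i j, i ≠ j → ∀ f : A i ⟶ A j, f = 0) →
    HasRealSl2Blocks (AbelianVariety.finProd k A)
  | 0, _, h, _ => h 0
  | k + 1, A, h, horth => by
    rw [AbelianVariety.finProd_succ]
    refine (hasRealSl2Blocks_finProd k (fun i => A i.castSucc) (fun i => h i.castSucc)
      (fun i j hij => horth i.castSucc j.castSucc fun e => hij (Fin.castSucc_injective (k + 1) e))).prod
      (h (Fin.last (k + 1))) ?_ ?_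
    · exact hom_finProd_eq_zero k (fun i => A i.castSucc) fun i =>
        horth i.castSucc (Fin.last (k + 1)) (Fin.castSucc_lt_last i).ne
    · exact hom_to_finProd_eq_zero k (fun i => A i.castSucc) fun i =>
        horth (Fin.last (k + 1)) i.castSucc (Fin.castSucc_lt_last i).ne'

/-- **Condition (D) for `A₀ × ⋯ × A_k`.** [cite: MoonenZarhin1999LowDim, §3 Thm. (3.2)(1)] [cite: Gordon1999HodgeAVSurvey, Thm. 7.6.2] -/
theorem isStablyNondegenerate_finProd (k : ℕ) (A : Fin (k + 1) → AbelianVariety ℂ)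
    (h : ∀ i, HasRealSl2Blocks (A i)) (horth : ∀ i j, i ≠ j → ∀ f : A i ⟶ A j, f = 0) :
    IsStablyNondegenerate (AbelianVariety.finProd k A) :=
  (hasRealSl2Blocks_finProd k A h horth).isStablyNondegenerate

/-- **The Hodge conjecture for every power of `A₀ × ⋯ × A_k`**, unconditionally. [cite: MoonenZarhin1999LowDim, §3 Thm. (3.2)(1)]
[cite: Hazama1989, Thm. (= Gordon 7.6.2)] -/
theorem hodgeConjectureFor_finProd_powSucc (k : ℕ) (A : Fin (k + 1) → AbelianVariety ℂ)
    (h : ∀ i, HasRealSl2Blocks (A i)) (horth : ∀ i j, i ≠ j → ∀ f : A i ⟶ A j, f = 0) (N : ℕ) :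
    HodgeConjectureFor ((AbelianVariety.finProd k A).powSucc N).dim ((AbelianVariety.finProd k A).powSucc N).X :=
  (hasRealSl2Blocks_finProd k A h horth).hodgeConjectureFor_powSucc N

/-- The Hodge conjecture for everything isogenous to a power of `A₀ × ⋯ × A_k`. [cite: vanGeemen1994HodgeAV, Lemma 3.7]
[cite: MoonenZarhin1999LowDim, §3 Thm. (3.2)(1)] -/
theorem hodgeConjectureFor_of_isIsogenous_finProd_powSucc (k : ℕ) (A : Fin (k + 1) → AbelianVariety ℂ)
    (h : ∀ i, HasRealSl2Blocks (A i)) (horth : ∀ i j, i ≠ j → ∀ f : A i ⟶ A j, f = 0) {X : AbelianVariety ℂ}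
    {N : ℕ} (hX : X.IsIsogenous ((AbelianVariety.finProd k A).powSucc N)) : HodgeConjectureFor X.dim X.X :=
  (hasRealSl2Blocks_finProd k A h horth).hodgeConjectureFor_of_isIsogenous_powSucc hX

/-- **The real-multiplication instance (Moonen–Zarhin (3.2)(1) iterated / Hazama 1989): a finite family of complex
abelian varieties `A_i` whose endomorphism algebras are totally real fields of degree `dim A_i`, pairwise orthogonal
(`Hom(A_i, A_j) = 0`, `i ≠ j` — e.g. simple and pairwise non-isogenous), has a product with real `𝔰𝔩₂`-block data;
in particular `A₀ × ⋯ × A_k` satisfies condition (D) and the Hodge conjecture holds for all its powers.**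
[cite: MoonenZarhin1999LowDim, §3 Thm. (3.2)(1)] [cite: Hazama1989, Thm. (= Gordon 7.6.2)] [cite: Ribet1983, Thm. 0–1] -/
theorem hasRealSl2Blocks_finProd_of_isTotallyReal (k : ℕ) (A : Fin (k + 1) → AbelianVariety ℂ)
    (hF : ∀ i, IsField (A i).endAlgebra) (hT : ∀ i, IsTotallyReal (EndField (A i) (hF i)))
    (hdeg : ∀ i, Module.finrank ℚ (A i).endAlgebra = (A i).dim)
    (horth : ∀ i j, i ≠ j → ∀ f : A i ⟶ A j, f = 0) : HasRealSl2Blocks (AbelianVariety.finProd k A) :=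
  hasRealSl2Blocks_finProd k A (fun i => haveI := hT i; hasRealSl2Blocks_of_isTotallyReal (A i) (hF i) (hdeg i))
    horth

/-- The Hodge conjecture for every power of such a product, unconditionally. [cite: MoonenZarhin1999LowDim, §3 Thm. (3.2)(1)]
[cite: Hazama1989, Thm. (= Gordon 7.6.2)] -/
theorem hodgeConjectureFor_finProd_powSucc_of_isTotallyReal (k : ℕ) (A : Fin (k + 1) → AbelianVariety ℂ)
    (hF : ∀ i, IsField (A i).endAlgebra) (hT : ∀ i, IsTotallyReal (EndField (A i) (hF i)))
    (hdeg : ∀ i, Module.finrank ℚ (A i).endAlgebra = (A i).dim)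
    (horth : ∀ i j, i ≠ j → ∀ f : A i ⟶ A j, f = 0) (N : ℕ) :
    HodgeConjectureFor ((AbelianVariety.finProd k A).powSucc N).dim ((AbelianVariety.finProd k A).powSucc N).X :=
  (hasRealSl2Blocks_finProd_of_isTotallyReal k A hF hT hdeg horth).hodgeConjectureFor_powSucc N

/-! ### Mixed powers `A₀^{n₀+1} × ⋯ × A_k^{n_k+1}` -/

/-- **`B = D` for every `A₀^{n₀+1} × ⋯ × A_k^{n_k+1}`** (a retract of a power of `A₀ × ⋯ × A_k`).
[cite: MoonenZarhin1999LowDim, §3 Thm. (3.2)(1)] [cite: vanGeemen1994HodgeAV, §2.4–2.5 (p. 235) and §3.6–3.7 (p. 236)] -/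
theorem isDivisorGenerated_finProd_mixedPowers (k : ℕ) (A : Fin (k + 1) → AbelianVariety ℂ)
    (h : ∀ i, HasRealSl2Blocks (A i)) (horth : ∀ i j, i ≠ j → ∀ f : A i ⟶ A j, f = 0) (n : Fin (k + 1) → ℕ) :
    IsDivisorGenerated (AbelianVariety.finProd k (fun i => (A i).powSucc (n i))) :=
  IsDivisorGenerated.finProd_powSucc_of_forall (hasRealSl2Blocks_finProd k A h horth).isDivisorGenerated_powSucc n

/-- **The Hodge conjecture for every `A₀^{n₀+1} × ⋯ × A_k^{n_k+1}`**, unconditionally.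
[cite: MoonenZarhin1999LowDim, §3 Thm. (3.2)(1)] [cite: Hazama1989, Thm. (= Gordon 7.6.2)] -/
theorem hodgeConjectureFor_finProd_mixedPowers (k : ℕ) (A : Fin (k + 1) → AbelianVariety ℂ)
    (h : ∀ i, HasRealSl2Blocks (A i)) (horth : ∀ i j, i ≠ j → ∀ f : A i ⟶ A j, f = 0) (n : Fin (k + 1) → ℕ) :
    HodgeConjectureFor (AbelianVariety.finProd k (fun i => (A i).powSucc (n i))).dim
      (AbelianVariety.finProd k (fun i => (A i).powSucc (n i))).X :=
  hodgeConjectureFor_of_isDivisorGenerated _ (isDivisorGenerated_finProd_mixedPowers k A h horth n)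

/-- The Hodge conjecture for everything isogenous to some `A₀^{n₀+1} × ⋯ × A_k^{n_k+1}`. [cite: vanGeemen1994HodgeAV, Lemma 3.7]
[cite: MoonenZarhin1999LowDim, §3 Thm. (3.2)(1)] -/
theorem hodgeConjectureFor_of_isIsogenous_finProd_mixedPowers (k : ℕ) (A : Fin (k + 1) → AbelianVariety ℂ)
    (h : ∀ i, HasRealSl2Blocks (A i)) (horth : ∀ i j, i ≠ j → ∀ f : A i ⟶ A j, f = 0) (n : Fin (k + 1) → ℕ)
    {X : AbelianVariety ℂ} (hX : X.IsIsogenous (AbelianVariety.finProd k (fun i => (A i).powSucc (n i)))) :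
    HodgeConjectureFor X.dim X.X :=
  HodgeConjectureFor.of_isIsogenous hX (hodgeConjectureFor_finProd_mixedPowers k A h horth n)

/-- **Real-multiplication instance, mixed powers: the Hodge conjecture for every
`A₀^{n₀+1} × ⋯ × A_k^{n_k+1}`**, `End⁰(A_i)` totally real fields of degree `dim A_i`, `Hom(A_i, A_j) = 0` (`i ≠ j`),
UNCONDITIONALLY. [cite: MoonenZarhin1999LowDim, §3 Thm. (3.2)(1)] [cite: Hazama1989, Thm. (= Gordon 7.6.2)]
[cite: Ribet1983, Thm. 0–1] -/
theorem hodgeConjectureFor_finProd_mixedPowers_of_isTotallyReal (k : ℕ) (A : Fin (k + 1) → AbelianVariety ℂ)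
    (hF : ∀ i, IsField (A i).endAlgebra) (hT : ∀ i, IsTotallyReal (EndField (A i) (hF i)))
    (hdeg : ∀ i, Module.finrank ℚ (A i).endAlgebra = (A i).dim)
    (horth : ∀ i j, i ≠ j → ∀ f : A i ⟶ A j, f = 0) (n : Fin (k + 1) → ℕ) :
    HodgeConjectureFor (AbelianVariety.finProd k (fun i => (A i).powSucc (n i))).dim
      (AbelianVariety.finProd k (fun i => (A i).powSucc (n i))).X :=
  hodgeConjectureFor_finProd_mixedPowers k A
    (fun i => haveI := hT i; hasRealSl2Blocks_of_isTotallyReal (A i) (hF i) (hdeg i)) horth n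

/-! ### The Lie algebra clause: `Hg(A₀ × ⋯ × A_k) = Hg(A₀) × ⋯ × Hg(A_k)` in Lie form -/

/-- **`Lie Hg(A₀ × ⋯ × A_k) = 𝔰𝔭_{End⁰}(H¹, ψ)`** for a finite pairwise orthogonal family of carriers and every
polarization `ψ` of `H¹(A₀ × ⋯ × A_k)` («`Hg(X₁ × X₂) = Hg(X₁) × Hg(X₂)`» iterated, Lie form).
[cite: MoonenZarhin1999LowDim, §3 Thm. (3.2)(1)] [cite: Hazama1983, §3 (pp. 305–306)] -/
theorem mem_hodgeLie_hodge_one_finProd_iff [HodgeTensorFacts.{0, 0}] (k : ℕ) (A : Fin (k + 1) → AbelianVariety ℂ)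
    [Module.Finite ℚ (bettiCohomology (AbelianVariety.finProd k A).X 1)]
    (h : ∀ i, HasRealSl2Blocks (A i)) (horth : ∀ i j, i ≠ j → ∀ f : A i ⟶ A j, f = 0)
    (hHD : exists_isReal_hodgeModel) (hI : hodgePQ_independent_of_hodgeModel)
    (ψ : (BettiUniverse.hodge hHD
      (AbelianVariety.isSmoothProjective_holds (A := AbelianVariety.finProd k A)) 1).Polarization)
    (X : Module.End ℚ (bettiCohomology (AbelianVariety.finProd k A).X 1)) :
    X ∈ (BettiUniverse.hodge hHD
        (AbelianVariety.isSmoothProjective_holds (A := AbelianVariety.finProd k A)) 1).hodgeLie ↔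
      (∀ z : (AbelianVariety.finProd k A).endAlgebra,
          X * MulOpposite.unop (bettiRep (AbelianVariety.finProd k A) z) =
            MulOpposite.unop (bettiRep (AbelianVariety.finProd k A) z) * X) ∧
      (∀ v w, ψ.form (X v) w + ψ.form v (X w) = 0) :=
  (hasRealSl2Blocks_finProd k A h horth).mem_hodgeLie_hodge_one_iff hHD hI ψ X

/-! ### The product-lane row `(A₀^{n₀+1} × ⋯ × A_k^{n_k+1}) × C`, `C` of CM type (conditional on HC_CM and the span fact) -/

/-- `A₀ × ⋯ × A_k` has no factor of type IV when no `A_i` has (`HasNoTypeIVFactor.prod` iterated).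
[cite: MoonenZarhin1999LowDim, §1 and Thm. (3.2)] [cite: MumfordAV1970, §19 Cor. 2 (p. 174)] -/
theorem hasNoTypeIVFactor_finProd : ∀ (k : ℕ) (A : Fin (k + 1) → AbelianVariety ℂ),
    (∀ i, HasNoTypeIVFactor (A i)) → HasNoTypeIVFactor (AbelianVariety.finProd k A)
  | 0, _, h => h 0
  | k + 1, A, h => (hasNoTypeIVFactor_finProd k (fun i => A i.castSucc) fun i => h i.castSucc).prod
      (h (Fin.last (k + 1)))

/-- **HC_CM ∧ span fact ⟹ HC(`(A₀^{n₀+1} × ⋯ × A_k^{n_k+1}) × C`)** for a finite pairwise orthogonal family of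
carriers of real `𝔰𝔩₂`-block data (no type-IV factors: `HasRealSl2Blocks.hasNoTypeIVFactor`) and `C` of CM type: the
first factor is UNCONDITIONAL (`isDivisorGenerated_finProd_mixedPowers`); binders displayed: `hCM` (HC for CM abelian varieties, Milne's
per-variety form), `hL` (`Lombardo2016_hodgeClassesProductSpan`). HONEST FRAMING: research route conditional on
HC_CM; not a corollary. [cite: MoonenZarhin1999LowDim, §1 and §3 Thm. (3.2)] [cite: Lombardo2016, Lemma 3.4 (p. 1229)] -/
theorem hodgeConjectureFor_finProd_mixedPowers_prod_cmType_of_cmHodgeHypothesis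
    (hCM : ∀ B : AbelianVariety ℂ, Milne1999.CMHodgeHypothesisAt B)
    (hL : Lombardo2016_hodgeClassesProductSpan) (k : ℕ) (A : Fin (k + 1) → AbelianVariety ℂ)
    (C : AbelianVariety ℂ) (h : ∀ i, HasRealSl2Blocks (A i))
    (horth : ∀ i j, i ≠ j → ∀ f : A i ⟶ A j, f = 0) (hCt : Milne1999.IsOfCMType C) (n : Fin (k + 1) → ℕ) :
    HodgeConjectureFor ((AbelianVariety.finProd k (fun i => (A i).powSucc (n i))).prod C).dim
      ((AbelianVariety.finProd k (fun i => (A i).powSucc (n i))).prod C).X :=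
  hodgeConjectureFor_prod_of_cmHodgeHypothesis_of_isDivisorGenerated hCM hL _ C
    (hasNoTypeIVFactor_finProd k _ fun i => (h i).hasNoTypeIVFactor.powSucc (n i)) hCt
    (isDivisorGenerated_finProd_mixedPowers k A h horth n)

/-- **Real-multiplication instance of the row**: `End⁰(A_i)` totally real fields of degree `dim A_i`, pairwise orthogonal, `C` of CM type: HC_CM ∧ span fact ⟹
HC(`(A₀^{n₀+1} × ⋯ × A_k^{n_k+1}) × C`). [cite: MoonenZarhin1999LowDim, §1 and §3 Thm. (3.2)] [cite: Lombardo2016, Lemma 3.4 (p. 1229)]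
[cite: Ribet1983, Thm. 0–1] -/
theorem hodgeConjectureFor_finProd_mixedPowers_prod_cmType_of_isTotallyReal_of_cmHodgeHypothesis
    (hCM : ∀ B : AbelianVariety ℂ, Milne1999.CMHodgeHypothesisAt B)
    (hL : Lombardo2016_hodgeClassesProductSpan) (k : ℕ) (A : Fin (k + 1) → AbelianVariety ℂ)
    (C : AbelianVariety ℂ) (hF : ∀ i, IsField (A i).endAlgebra) (hT : ∀ i, IsTotallyReal (EndField (A i) (hF i)))
    (hdeg : ∀ i, Module.finrank ℚ (A i).endAlgebra = (A i).dim)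
    (horth : ∀ i j, i ≠ j → ∀ f : A i ⟶ A j, f = 0) (hCt : Milne1999.IsOfCMType C) (n : Fin (k + 1) → ℕ) :
    HodgeConjectureFor ((AbelianVariety.finProd k (fun i => (A i).powSucc (n i))).prod C).dim
      ((AbelianVariety.finProd k (fun i => (A i).powSucc (n i))).prod C).X :=
  hodgeConjectureFor_finProd_mixedPowers_prod_cmType_of_cmHodgeHypothesis hCM hL k A C
    (fun i => haveI := hT i; hasRealSl2Blocks_of_isTotallyReal (A i) (hF i) (hdeg i)) horth hCt n

/-! ### Simple, pairwise non-isogenous factors -/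

/-- **Pairwise orthogonality from simplicity and pairwise non-isogeny** (`Hom(A_i, A_j) = 0` for `A_i`, `A_j` simple
and not isogenous, `orthogonal_of_isSimple_of_not_isIsogenous₂`). [cite: MumfordAV1970, §19 Cor. 2 (p. 174)] -/
theorem orthogonal_of_isSimple_of_pairwise_not_isIsogenous {k : ℕ} {A : Fin (k + 1) → AbelianVariety ℂ}
    (hS : ∀ i, (A i).IsSimple) (hN : ∀ i j, i ≠ j → ¬ AbelianVariety.IsIsogenous (A i) (A j)) :
    ∀ i j, i ≠ j → ∀ f : A i ⟶ A j, f = 0 :=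
  fun i j hij => (orthogonal_of_isSimple_of_not_isIsogenous₂ (hS i) (hS j) (hN i j hij)).1

/-- **The Hodge conjecture for every `A₀^{n₀+1} × ⋯ × A_k^{n_k+1}`, `A_i` SIMPLE, PAIRWISE NON-ISOGENOUS, with
`End⁰(A_i)` totally real fields of degree `dim A_i` — UNCONDITIONAL** (Moonen–Zarhin (3.2)(1) / Hazama 1989 iterated,
in the phrasing of the sources). [cite: MoonenZarhin1999LowDim, §3 Thm. (3.2)(1)] [cite: Hazama1989, Thm. (= Gordon 7.6.2)]
[cite: Ribet1983, Thm. 0–1] -/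
theorem hodgeConjectureFor_finProd_mixedPowers_of_isTotallyReal_of_isSimple (k : ℕ)
    (A : Fin (k + 1) → AbelianVariety ℂ) (hF : ∀ i, IsField (A i).endAlgebra)
    (hT : ∀ i, IsTotallyReal (EndField (A i) (hF i))) (hdeg : ∀ i, Module.finrank ℚ (A i).endAlgebra = (A i).dim)
    (hS : ∀ i, (A i).IsSimple) (hN : ∀ i j, i ≠ j → ¬ AbelianVariety.IsIsogenous (A i) (A j))
    (n : Fin (k + 1) → ℕ) :
    HodgeConjectureFor (AbelianVariety.finProd k (fun i => (A i).powSucc (n i))).dim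
      (AbelianVariety.finProd k (fun i => (A i).powSucc (n i))).X :=
  hodgeConjectureFor_finProd_mixedPowers_of_isTotallyReal k A hF hT hdeg
    (orthogonal_of_isSimple_of_pairwise_not_isIsogenous hS hN) n

/-- The same for everything isogenous to such a mixed power. [cite: vanGeemen1994HodgeAV, Lemma 3.7]
[cite: MoonenZarhin1999LowDim, §3 Thm. (3.2)(1)] -/
theorem hodgeConjectureFor_of_isIsogenous_finProd_mixedPowers_of_isTotallyReal_of_isSimple (k : ℕ)
    (A : Fin (k + 1) → AbelianVariety ℂ) (hF : ∀ i, IsField (A i).endAlgebra)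
    (hT : ∀ i, IsTotallyReal (EndField (A i) (hF i))) (hdeg : ∀ i, Module.finrank ℚ (A i).endAlgebra = (A i).dim)
    (hS : ∀ i, (A i).IsSimple) (hN : ∀ i j, i ≠ j → ¬ AbelianVariety.IsIsogenous (A i) (A j))
    (n : Fin (k + 1) → ℕ) {X : AbelianVariety ℂ}
    (hX : X.IsIsogenous (AbelianVariety.finProd k (fun i => (A i).powSucc (n i)))) :
    HodgeConjectureFor X.dim X.X :=
  HodgeConjectureFor.of_isIsogenous hX
    (hodgeConjectureFor_finProd_mixedPowers_of_isTotallyReal_of_isSimple k A hF hT hdeg hS hN n)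

/-- **Condition (D) for `A₀ × ⋯ × A_k`**, `A_i` simple, pairwise non-isogenous, `End⁰(A_i)` totally real fields of
degree `dim A_i`. [cite: MoonenZarhin1999LowDim, §3 Thm. (3.2)(1)] [cite: Gordon1999HodgeAVSurvey, Thm. 7.6.2] -/
theorem isStablyNondegenerate_finProd_of_isTotallyReal_of_isSimple (k : ℕ) (A : Fin (k + 1) → AbelianVariety ℂ)
    (hF : ∀ i, IsField (A i).endAlgebra) (hT : ∀ i, IsTotallyReal (EndField (A i) (hF i)))
    (hdeg : ∀ i, Module.finrank ℚ (A i).endAlgebra = (A i).dim) (hS : ∀ i, (A i).IsSimple)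
    (hN : ∀ i j, i ≠ j → ¬ AbelianVariety.IsIsogenous (A i) (A j)) :
    IsStablyNondegenerate (AbelianVariety.finProd k A) :=
  (hasRealSl2Blocks_finProd_of_isTotallyReal k A hF hT hdeg
    (orthogonal_of_isSimple_of_pairwise_not_isIsogenous hS hN)).isStablyNondegenerate

/-- **HC_CM ∧ span fact ⟹ HC(`(A₀^{n₀+1} × ⋯ × A_k^{n_k+1}) × C`)**, `A_i` simple pairwise non-isogenous RM of relative
dimension one, `C` of CM type (binders `hCM`, `hL` displayed; HONEST FRAMING: research route conditional on HC_CM; not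
a corollary). [cite: MoonenZarhin1999LowDim, §1 and §3 Thm. (3.2)] [cite: Lombardo2016, Lemma 3.4 (p. 1229)] -/
theorem hodgeConjectureFor_finProd_mixedPowers_prod_cmType_of_isTotallyReal_of_isSimple_of_cmHodgeHypothesis
    (hCM : ∀ B : AbelianVariety ℂ, Milne1999.CMHodgeHypothesisAt B)
    (hL : Lombardo2016_hodgeClassesProductSpan) (k : ℕ) (A : Fin (k + 1) → AbelianVariety ℂ)
    (C : AbelianVariety ℂ) (hF : ∀ i, IsField (A i).endAlgebra) (hT : ∀ i, IsTotallyReal (EndField (A i) (hF i)))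
    (hdeg : ∀ i, Module.finrank ℚ (A i).endAlgebra = (A i).dim) (hS : ∀ i, (A i).IsSimple)
    (hN : ∀ i j, i ≠ j → ¬ AbelianVariety.IsIsogenous (A i) (A j)) (hCt : Milne1999.IsOfCMType C)
    (n : Fin (k + 1) → ℕ) :
    HodgeConjectureFor ((AbelianVariety.finProd k (fun i => (A i).powSucc (n i))).prod C).dim
      ((AbelianVariety.finProd k (fun i => (A i).powSucc (n i))).prod C).X :=
  hodgeConjectureFor_finProd_mixedPowers_prod_cmType_of_isTotallyReal_of_cmHodgeHypothesis hCM hL k A C hF hT hdeg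
    (orthogonal_of_isSimple_of_pairwise_not_isIsogenous hS hN) hCt n

/-! ### Condition (D) for all mixed powers -/

/-- **Every mixed power `A₀^{n₀+1} × ⋯ × A_k^{n_k+1}` of a finite pairwise orthogonal family of carriers is STABLY
NONDEGENERATE** (condition (D); `IsStablyNondegenerate.finProd_powSucc` of `FiniteProductsMixedPowersRetract`).
[cite: MoonenZarhin1999LowDim, §2 condition (D) and §3 Thm. (3.2)(1)] [cite: Gordon1999HodgeAVSurvey, Thm. 7.6.2] -/
theorem isStablyNondegenerate_finProd_mixedPowers (k : ℕ) (A : Fin (k + 1) → AbelianVariety ℂ)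
    (h : ∀ i, HasRealSl2Blocks (A i)) (horth : ∀ i j, i ≠ j → ∀ f : A i ⟶ A j, f = 0) (n : Fin (k + 1) → ℕ) :
    IsStablyNondegenerate (AbelianVariety.finProd k (fun i => (A i).powSucc (n i))) :=
  (isStablyNondegenerate_finProd k A h horth).finProd_powSucc n

/-- Real-multiplication instance: every `A₀^{n₀+1} × ⋯ × A_k^{n_k+1}`, `End⁰(A_i)` totally real fields of degree
`dim A_i`, `Hom(A_i, A_j) = 0` (`i ≠ j`), is stably nondegenerate. [cite: MoonenZarhin1999LowDim, §3 Thm. (3.2)(1)]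
[cite: Hazama1989, Thm. (= Gordon 7.6.2)] -/
theorem isStablyNondegenerate_finProd_mixedPowers_of_isTotallyReal (k : ℕ) (A : Fin (k + 1) → AbelianVariety ℂ)
    (hF : ∀ i, IsField (A i).endAlgebra) (hT : ∀ i, IsTotallyReal (EndField (A i) (hF i)))
    (hdeg : ∀ i, Module.finrank ℚ (A i).endAlgebra = (A i).dim)
    (horth : ∀ i j, i ≠ j → ∀ f : A i ⟶ A j, f = 0) (n : Fin (k + 1) → ℕ) :
    IsStablyNondegenerate (AbelianVariety.finProd k (fun i => (A i).powSucc (n i))) :=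
  (hasRealSl2Blocks_finProd_of_isTotallyReal k A hF hT hdeg horth).isStablyNondegenerate.finProd_powSucc n

/-- The same for SIMPLE, PAIRWISE NON-ISOGENOUS `A_i`. [cite: MoonenZarhin1999LowDim, §3 Thm. (3.2)(1)]
[cite: Gordon1999HodgeAVSurvey, Thm. 7.6.2] -/
theorem isStablyNondegenerate_finProd_mixedPowers_of_isTotallyReal_of_isSimple (k : ℕ)
    (A : Fin (k + 1) → AbelianVariety ℂ) (hF : ∀ i, IsField (A i).endAlgebra)
    (hT : ∀ i, IsTotallyReal (EndField (A i) (hF i))) (hdeg : ∀ i, Module.finrank ℚ (A i).endAlgebra = (A i).dim)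
    (hS : ∀ i, (A i).IsSimple) (hN : ∀ i j, i ≠ j → ¬ AbelianVariety.IsIsogenous (A i) (A j))
    (n : Fin (k + 1) → ℕ) :
    IsStablyNondegenerate (AbelianVariety.finProd k (fun i => (A i).powSucc (n i))) :=
  isStablyNondegenerate_finProd_mixedPowers_of_isTotallyReal k A hF hT hdeg
    (orthogonal_of_isSimple_of_pairwise_not_isIsogenous hS hN) n

/-- Two factors: `A^{M+1} × B^{N+1}` is stably nondegenerate for orthogonal carriers `A`, `B`.
[cite: MoonenZarhin1999LowDim, §3 Thm. (3.2)(1)] [cite: Gordon1999HodgeAVSurvey, Thm. 7.6.2] -/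
theorem HasRealSl2Blocks.isStablyNondegenerate_powSucc_prod_powSucc {A B : AbelianVariety ℂ}
    (hA : HasRealSl2Blocks A) (hB : HasRealSl2Blocks B) (hAB : ∀ f : A ⟶ B, f = 0) (hBA : ∀ g : B ⟶ A, g = 0)
    (M N : ℕ) : IsStablyNondegenerate ((A.powSucc M).prod (B.powSucc N)) :=
  (hA.isStablyNondegenerate_prod hB hAB hBA).powSucc_prod_powSucc M N

end Literature.AlgebraicGeometry.HodgeTheory

end
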